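import Literature.Computability.FineGrained.IPRenameEvaluator
import HarnessLib

/-!
# The renaming machine of Impagliazzo–Paturi's Lemma 2, VII: the evaluator of a slice constraint; the evaluators compute gClause and theta

Family `fine-grained` (trunk T-CPLX-FINE). Seventh file of the machine half of Impagliazzo–Paturi's Lemma 2. It completes the evaluators
and plugs them into the emission loop of `IPRenameTruthTable.lean`.

* `fBody` / `fPart` / `runs_fPart` — read `f_i` (the leading blanks of block `i` of the
  `Y`-table) in unary; `thetaFlag`, `thetaEval` / **`runs_thetaEval`** — the evaluator of
  `Θ_i`: block pass with target position `0`, `f_i`, comparison of the two unary counts by the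
  generic `cmpU` (`IPRenameLoops.lean`), `g` raised iff they are equal.
* **The evaluators are correct**: `fT_entries`, `fr_entries` (table predicates at the tuple
  `V.zip bs` are the forcing predicates at `asg V bs`), `bval_eq_psi` (the value of a `B`-literal
  computed from the tables `btab`, `ytab` is `IPRename.psi`), `alSat_eq_gClause` (the scan
  computes `IPRename.gClause`), `annLit_wf`, `countP_fr_eq_iff_theta` (the `Θ`-test is
  `IPRename.theta`).
* **Inside the emission loop**: `KBase`, `ScanClean`, `ThetaClean` (what the work registers must
  hold), `runs_evalClause_elim`, `runs_thetaEval_elim` (the evaluators on the joint store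
  `Sum.elim (tbSt …) T`), and the two instances of `runs_cnfLoop_cnf`:
  **`runs_cnfLoop_gClause`** — the loop around `evalClause` pushes `wFam (cnf (gClause P F c) V)`;
  **`runs_cnfLoop_theta`** — the loop around `thetaEval` pushes `wFam (cnf (theta P F i) V)`.
  These are exactly the clauses of `IPRename.reduce` (`outClauses`), so what remains for the
  machine is to build the register contents (tables, annotated clauses, dependency lists) and
  to drive these loops over the clauses and blocks.

## References

* R. Impagliazzo, R. Paturi, *On the complexity of k-SAT*, J. Comput. System Sci. 62 (2001)
  367–375, doi:10.1006/jcss.2000.1727, Lemma 2 (p. 373) and its "Moreover" sentence (the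
  reduction is computable within the stated time); pp. 371–372 (`G_x`, `Ψ`, `Θ_i`, `Φ_f`).
  (Not held; acquisition request acq-00143.)
* T. Nipkow, G. Klein, *Concrete Semantics with Isabelle/HOL*, Springer 2014, Ch. 7 (big-step
  reasoning about loops, as in `SymbolPrograms.lean`).
-/

namespace Literature.Computability.FineGrained.IPRenameM

open _root_.Computability Complexity Complexity.ACom Sparsifier IPRename

/-! ### Reading `f_i` off the `Y`-table -/

/-- Body of the pass reading `f_i`: skip `iu2` blocks (mode `bra`), count the leading blanks of
the next block in `u1` (mode empty), ignore the rest (mode `blank`). [folklore] -/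
def fBody (s : Γ') : RProg :=
  pop (kr KR.md2) fun o => match o, s with
    | some Γ'.bra, Γ'.ket => pop (kr KR.iu2) fun _ => ifTop (kr KR.iu2) fun o' => match o' with
        | some _ => push (kr KR.md2) Γ'.bra
        | none => skip
    | some Γ'.bra, _ => push (kr KR.md2) Γ'.bra
    | none, Γ'.blank => push (kr KR.u1) Γ'.blank
    | none, _ => push (kr KR.md2) Γ'.blank
    | some Γ'.blank, _ => push (kr KR.md2) Γ'.blank
    | _, _ => skip

/-- `fPart`: with `iu2 = i` ticks, set `u1` to `f_i` ticks read off block `i` of the `Y`-table `yt`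
(kept), emptying `iu2`. [folklore] -/
def fPart : RProg :=
  copyToG (kr KR.yt) (kr KR.ytw) (kr KR.t1) (kr KR.t2) ;;
  (ifTop (kr KR.iu2) fun o => match o with
    | some _ => push (kr KR.md2) Γ'.bra
    | none => skip) ;;
  loop (kr KR.ytw) fBody ;; clear (kr KR.md2)

/-- The store during `fPart`. [folklore] -/
def fSt (S : RStore) (ytw md2 iu2 u1 : List Γ') : RStore := fun r =>
  if r = kr KR.ytw then ytw else if r = kr KR.md2 then md2 else if r = kr KR.iu2 then iu2 else
  if r = kr KR.u1 then u1 else S r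

section FSt

variable (S : RStore) (ytw md2 iu2 u1 w : List Γ')

/-- Reading `ytw`. [folklore] -/
@[simp] theorem fSt_ytw : fSt S ytw md2 iu2 u1 (kr KR.ytw) = ytw := by simp [fSt]
/-- Reading `md2`. [folklore] -/
@[simp] theorem fSt_md2 : fSt S ytw md2 iu2 u1 (kr KR.md2) = md2 := by simp [fSt]
/-- Reading `iu2`. [folklore] -/
@[simp] theorem fSt_iu2 : fSt S ytw md2 iu2 u1 (kr KR.iu2) = iu2 := by simp [fSt]
/-- Reading `u1`. [folklore] -/
@[simp] theorem fSt_u1 : fSt S ytw md2 iu2 u1 (kr KR.u1) = u1 := by simp [fSt]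
/-- Reading any other register. [folklore] -/
theorem fSt_other {r : Reg} (h0 : r ≠ kr KR.ytw) (h1 : r ≠ kr KR.md2) (h2 : r ≠ kr KR.iu2) (h3 : r ≠ kr KR.u1) :
    fSt S ytw md2 iu2 u1 r = S r := by simp [fSt, h0, h1, h2, h3]
/-- Reading `yt`. [folklore] -/
@[simp] theorem fSt_yt : fSt S ytw md2 iu2 u1 (kr KR.yt) = S (kr KR.yt) := by simp [fSt]
/-- Reading `t1`. [folklore] -/
@[simp] theorem fSt_t1 : fSt S ytw md2 iu2 u1 (kr KR.t1) = S (kr KR.t1) := by simp [fSt]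
/-- Reading `t2`. [folklore] -/
@[simp] theorem fSt_t2 : fSt S ytw md2 iu2 u1 (kr KR.t2) = S (kr KR.t2) := by simp [fSt]
/-- Updating `ytw`. [folklore] -/
@[simp] theorem update_fSt_ytw : Function.update (fSt S ytw md2 iu2 u1) (kr KR.ytw) w = fSt S w md2 iu2 u1 := by
  funext r; by_cases h : r = kr KR.ytw
  · subst h; simp
  · rw [Function.update_of_ne h]; simp [fSt, h]
/-- Updating `md2`. [folklore] -/
@[simp] theorem update_fSt_md2 : Function.update (fSt S ytw md2 iu2 u1) (kr KR.md2) w = fSt S ytw w iu2 u1 := by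
  funext r; by_cases h : r = kr KR.md2
  · subst h; simp
  · rw [Function.update_of_ne h]; simp [fSt, h]
/-- Updating `iu2`. [folklore] -/
@[simp] theorem update_fSt_iu2 : Function.update (fSt S ytw md2 iu2 u1) (kr KR.iu2) w = fSt S ytw md2 w u1 := by
  funext r; by_cases h : r = kr KR.iu2
  · subst h; simp
  · rw [Function.update_of_ne h]; simp [fSt, h]
/-- Updating `u1`. [folklore] -/
@[simp] theorem update_fSt_u1 : Function.update (fSt S ytw md2 iu2 u1) (kr KR.u1) w = fSt S ytw md2 iu2 w := by
  funext r; by_cases h : r = kr KR.u1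
  · subst h; simp
  · rw [Function.update_of_ne h]; simp [fSt, h]

end FSt

/-- Every store is an `fSt` over itself. [folklore] -/
theorem fSt_eta (R : RStore) : fSt R (R (kr KR.ytw)) (R (kr KR.md2)) (R (kr KR.iu2)) (R (kr KR.u1)) = R := by
  funext r
  by_cases h0 : r = kr KR.ytw; · subst h0; simp
  by_cases h1 : r = kr KR.md2; · subst h1; simp
  by_cases h2 : r = kr KR.iu2; · subst h2; simp
  by_cases h3 : r = kr KR.u1; · subst h3; simp
  rw [fSt_other _ _ _ _ _ h0 h1 h2 h3]

section FSpec

variable (S : RStore)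

/-- **Skipping** (mode `bra`): symbols other than `ket` are passed over. [folklore] -/
theorem segRuns_f_skip_inner (iu2 u1 : List Γ') :
    ∀ (u : List Γ'), Γ'.ket ∉ u → ∀ rest : List Γ',
      SegRuns (kr KR.ytw) fBody u (fSt S (u ++ rest) [Γ'.bra] iu2 u1) (fSt S rest [Γ'.bra] iu2 u1) (5 * u.length)
  | [], _, rest => by simpa using SegRuns.nil (kr KR.ytw) fBody _
  | s :: u, hu, rest => by
    have hs : s ≠ Γ'.ket := fun h => hu (by simp [h])
    have hu' : Γ'.ket ∉ u := fun h => hu (by simp [h])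
    have hbody : Runs (fBody s) (Function.update (fSt S (s :: u ++ rest) [Γ'.bra] iu2 u1) (kr KR.ytw) (u ++ rest))
        (fSt S (u ++ rest) [Γ'.bra] iu2 u1) (1 + 2) := by
      rw [update_fSt_ytw]
      unfold fBody
      refine Runs.pop_cons (k := kr KR.md2) (a := Γ'.bra) (w := []) (by simp) ?_
      rw [update_fSt_md2]
      cases s with
      | ket => exact absurd rfl hs
      | bit b => exact Runs.push' (by simp)
      | bra => exact Runs.push' (by simp)
      | blank => exact Runs.push' (by simp)
      | comma => exact Runs.push' (by simp)
    have ih := segRuns_f_skip_inner iu2 u1 u hu' rest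
    have hk : fSt S (s :: u ++ rest) [Γ'.bra] iu2 u1 (kr KR.ytw) = s :: (u ++ rest) := by simp
    refine (SegRuns.cons hk hbody ih).cast rfl rfl rfl ?_
    simp only [List.length_cons]; omega

/-- **Skipping one `Y`-block.** [folklore] -/
theorem segRuns_f_skip_block (u1 : List Γ') (f : ℕ) (ys : List ℕ) (u rest : List Γ') :
    SegRuns (kr KR.ytw) fBody (wYBlock f ys) (fSt S (wYBlock f ys ++ rest) [Γ'.bra] (Γ'.blank :: u) u1)
      (fSt S rest (if u = [] then [] else [Γ'.bra]) u u1) (10 * (wYBlock f ys).length) := by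
  rw [wYBlock_eq]
  set pre := List.replicate f Γ'.blank ++ Γ'.comma :: ys.flatMap wIdx with hpre
  have h1 := segRuns_f_skip_inner S (Γ'.blank :: u) u1 pre (by rw [hpre]; exact ket_not_mem_yBlock_prefix f ys)
    ([Γ'.ket] ++ rest)
  have h2 : Runs (fBody Γ'.ket) (Function.update (fSt S ([Γ'.ket] ++ rest) [Γ'.bra] (Γ'.blank :: u) u1) (kr KR.ytw) rest)
      (fSt S rest (if u = [] then [] else [Γ'.bra]) u u1) (4 + 2 + 2) := by
    rw [update_fSt_ytw]
    unfold fBody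
    refine Runs.pop_cons (k := kr KR.md2) (a := Γ'.bra) (w := []) (by simp) ?_
    rw [update_fSt_md2]
    refine Runs.pop_cons (k := kr KR.iu2) (a := Γ'.blank) (w := u) (by simp) ?_
    rw [update_fSt_iu2]
    cases u with
    | nil =>
      rw [if_pos rfl]
      exact (Runs.ifTop_nil (by simp) (Runs.skip _)).mono (by norm_num)
    | cons t u =>
      rw [if_neg (List.cons_ne_nil _ _)]
      exact Runs.ifTop_cons (x := t) (w := u) (by simp) (Runs.push' (by simp))
  have hk2 : fSt S ([Γ'.ket] ++ rest) [Γ'.bra] (Γ'.blank :: u) u1 (kr KR.ytw) = Γ'.ket :: rest := by simp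
  have := h1.append (SegRuns.single hk2 h2)
  refine this.cast rfl (by simp) rfl ?_
  simp only [List.length_append, List.length_singleton]; omega

/-- **Skipping the `Y`-blocks before the wanted one.** [folklore] -/
theorem segRuns_f_skip (u1 : List Γ') : ∀ (t : List (ℕ × List ℕ)) (u rest : List Γ'), t ≠ [] →
    SegRuns (kr KR.ytw) fBody (t.flatMap fun b => wYBlock b.1 b.2)
      (fSt S ((t.flatMap fun b => wYBlock b.1 b.2) ++ rest) [Γ'.bra] (ticks Γ'.blank t.length ++ u) u1)
      (fSt S rest (if u = [] then [] else [Γ'.bra]) u u1)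
      (10 * (t.flatMap fun b => wYBlock b.1 b.2).length)
  | [], _, _, h => absurd rfl h
  | [b], u, rest, _ => by
    have := segRuns_f_skip_block S u1 b.1 b.2 u rest
    refine this.cast (by simp) (by simp [ticks]) rfl (by simp)
  | b :: b' :: t, u, rest, _ => by
    have h1 := segRuns_f_skip_block S u1 b.1 b.2 (ticks Γ'.blank (b' :: t).length ++ u)
      (((b' :: t).flatMap fun b => wYBlock b.1 b.2) ++ rest)
    have hne : ticks Γ'.blank (b' :: t).length ++ u ≠ [] := by simp [ticks]
    rw [if_neg hne] at h1
    have h2 := segRuns_f_skip u1 (b' :: t) u rest (List.cons_ne_nil _ _)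
    have := h1.append h2
    refine this.cast (by simp) ?_ rfl ?_
    · simp [ticks, List.replicate_succ]
    · simp only [List.flatMap_cons, List.length_append]; omega

/-- **Counting the `f`-blanks of the wanted block**; the comma ends the count. [folklore] -/
theorem segRuns_f_blanks (f : ℕ) (rest u1 : List Γ') :
    SegRuns (kr KR.ytw) fBody (List.replicate f Γ'.blank ++ [Γ'.comma])
      (fSt S (List.replicate f Γ'.blank ++ [Γ'.comma] ++ rest) [] [] u1)
      (fSt S rest [Γ'.blank] [] (ticks Γ'.blank f ++ u1)) (5 * (f + 1)) := by
  have h1 : ∀ (rest' u1' : List Γ'), SegRuns (kr KR.ytw) fBody (List.replicate f Γ'.blank)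
      (fSt S (List.replicate f Γ'.blank ++ rest') [] [] u1') (fSt S rest' [] [] (ticks Γ'.blank f ++ u1')) (5 * f) := by
    induction f with
    | zero => intro rest' u1'; simpa using SegRuns.nil (kr KR.ytw) fBody _
    | succ f ih =>
      intro rest' u1'
      have hbody : Runs (fBody Γ'.blank)
          (Function.update (fSt S (Γ'.blank :: (List.replicate f Γ'.blank ++ rest')) [] [] u1') (kr KR.ytw)
            (List.replicate f Γ'.blank ++ rest'))
          (fSt S (List.replicate f Γ'.blank ++ rest') [] [] (Γ'.blank :: u1')) (1 + 2) := by
        rw [update_fSt_ytw]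
        unfold fBody
        exact Runs.pop_nil (by simp) (Runs.push' (by simp))
      have hk : fSt S (Γ'.blank :: (List.replicate f Γ'.blank ++ rest')) [] [] u1' (kr KR.ytw) =
          Γ'.blank :: (List.replicate f Γ'.blank ++ rest') := by simp
      refine (SegRuns.cons hk hbody (ih rest' (Γ'.blank :: u1'))).cast (by simp [List.replicate_succ])
        (by simp [List.replicate_succ]) ?_ (by omega)
      simp only [ticks, replicate_append_cons, List.replicate_succ, List.cons_append]
  have h2 : Runs (fBody Γ'.comma) (Function.update (fSt S ([Γ'.comma] ++ rest) [] [] (ticks Γ'.blank f ++ u1)) (kr KR.ytw) rest)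
      (fSt S rest [Γ'.blank] [] (ticks Γ'.blank f ++ u1)) (1 + 2) := by
    rw [update_fSt_ytw]
    unfold fBody
    exact Runs.pop_nil (by simp) (Runs.push' (by simp))
  have hk2 : fSt S ([Γ'.comma] ++ rest) [] [] (ticks Γ'.blank f ++ u1) (kr KR.ytw) = Γ'.comma :: rest := by simp
  have := (h1 ([Γ'.comma] ++ rest) u1).append (SegRuns.single hk2 h2)
  refine this.cast rfl (by simp) rfl ?_
  omega

/-- **Done**: every further symbol is ignored (mode `blank`). [folklore] -/
theorem segRuns_f_ignore (iu2 u1 : List Γ') :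
    ∀ (u rest : List Γ'), SegRuns (kr KR.ytw) fBody u (fSt S (u ++ rest) [Γ'.blank] iu2 u1)
      (fSt S rest [Γ'.blank] iu2 u1) (5 * u.length)
  | [], rest => by simpa using SegRuns.nil (kr KR.ytw) fBody _
  | s :: u, rest => by
    have hbody : Runs (fBody s) (Function.update (fSt S (s :: u ++ rest) [Γ'.blank] iu2 u1) (kr KR.ytw) (u ++ rest))
        (fSt S (u ++ rest) [Γ'.blank] iu2 u1) (1 + 2) := by
      rw [update_fSt_ytw]
      unfold fBody
      refine Runs.pop_cons (k := kr KR.md2) (a := Γ'.blank) (w := []) (by simp) ?_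
      rw [update_fSt_md2]
      cases s <;> exact Runs.push' (by simp)
    have ih := segRuns_f_ignore iu2 u1 u rest
    have hk : fSt S (s :: u ++ rest) [Γ'.blank] iu2 u1 (kr KR.ytw) = s :: (u ++ rest) := by simp
    refine (SegRuns.cons hk hbody ih).cast rfl rfl rfl ?_
    simp only [List.length_cons]; omega

/-- **Specification of `fPart`.** [folklore] -/
theorem runs_fPart (t : List (ℕ × List ℕ)) (i : ℕ) (hi : i < t.length) (hyt : S (kr KR.yt) = wYT t)
    (ht1 : S (kr KR.t1) = []) (ht2 : S (kr KR.t2) = []) :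
    Runs fPart (fSt S [] [] (ticks Γ'.blank i) []) (fSt S [] [] [] (ticks Γ'.blank (t[i]).1)) (20 * (wYT t).length + 11) := by
  set f := (t[i]).1 with hf
  set ys := (t[i]).2 with hys0
  have ht : t[i] = (f, ys) := by rw [hf, hys0]
  have hsplit : t = t.take i ++ (f, ys) :: t.drop (i + 1) := by
    rw [← ht, ← List.drop_eq_getElem_cons hi, List.take_append_drop]
  set B : ℕ × List ℕ → List Γ' := fun b => wYBlock b.1 b.2 with hBdef
  set tail := (t.drop (i + 1)).flatMap B with htail
  have hwYT : wYT t = (t.take i).flatMap B ++ (wYBlock f ys ++ tail) := by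
    conv_lhs => rw [hsplit]
    simp [wYT, hBdef, htail]
  unfold fPart
  have h0 := runs_copyToG (a := kr KR.yt) (b := kr KR.ytw) (t₁ := kr KR.t1) (t₂ := kr KR.t2)
    (by simp) (by simp) (by simp) (by simp) (by simp) (by simp) (fSt S [] [] (ticks Γ'.blank i) []) (by simp [ht1])
    (by simp [ht2]) (by simp)
  rw [fSt_yt, hyt, update_fSt_ytw] at h0
  have hpre : Runs ((ifTop (kr KR.iu2) fun o => match o with
        | some _ => push (kr KR.md2) Γ'.bra
        | none => skip)) (fSt S (wYT t) [] (ticks Γ'.blank i) [])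
      (fSt S (wYT t) (if i = 0 then [] else [Γ'.bra]) (ticks Γ'.blank i) []) 4 := by
    cases i with
    | zero =>
      rw [if_pos rfl]
      exact (Runs.ifTop_nil (by simp [ticks]) (Runs.skip _)).mono (by norm_num)
    | succ i =>
      rw [if_neg (Nat.succ_ne_zero i)]
      exact Runs.ifTop_cons (x := Γ'.blank) (w := ticks Γ'.blank i) (by simp [ticks_succ]) (Runs.push' (by simp))
  have hN5 : wYBlock f ys ++ tail = List.replicate f Γ'.blank ++ ([Γ'.comma] ++ (ys.flatMap wIdx ++ (Γ'.ket :: tail))) := by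
    rw [wYBlock_eq]; simp
  have hskip : SegRuns (kr KR.ytw) fBody ((t.take i).flatMap B)
      (fSt S (wYT t) (if i = 0 then [] else [Γ'.bra]) (ticks Γ'.blank i) [])
      (fSt S (List.replicate f Γ'.blank ++ [Γ'.comma] ++ (ys.flatMap wIdx ++ (Γ'.ket :: tail))) [] [] [])
      (10 * ((t.take i).flatMap B).length) := by
    have e : fSt S (List.replicate f Γ'.blank ++ [Γ'.comma] ++ (ys.flatMap wIdx ++ (Γ'.ket :: tail))) [] [] [] =
        fSt S (wYBlock f ys ++ tail) [] [] [] := by rw [hN5, List.append_assoc]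
    rw [e]
    cases i with
    | zero =>
      rw [if_pos rfl, hwYT]
      simp only [List.take_zero, List.flatMap_nil, List.nil_append, List.length_nil, Nat.mul_zero, ticks_zero]
      exact SegRuns.nil (kr KR.ytw) fBody _
    | succ i =>
      rw [if_neg (Nat.succ_ne_zero i)]
      have hne : t.take (i + 1) ≠ [] := by
        rw [Ne, List.take_eq_nil_iff]; simp only [Nat.succ_ne_zero, false_or]
        rintro rfl; simp at hi
      have hlen : (t.take (i + 1)).length = i + 1 := List.length_take_of_le (by omega)
      have := segRuns_f_skip S [] (t.take (i + 1)) [] (wYBlock f ys ++ tail) hne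
      rw [if_pos rfl, hlen, List.append_nil] at this
      refine this.cast rfl (by rw [hwYT]) rfl le_rfl
  have hblanks := segRuns_f_blanks S f (ys.flatMap wIdx ++ (Γ'.ket :: tail)) []
  rw [List.append_nil] at hblanks
  have hig := segRuns_f_ignore S [] (ticks Γ'.blank f) (ys.flatMap wIdx ++ (Γ'.ket :: tail)) []
  rw [List.append_nil] at hig
  have hloop := (hskip.append (hblanks.append hig)).runs_loop_nil (by simp)
  have hc := runs_clear (kr KR.md2) (fSt S [] [Γ'.blank] [] (ticks Γ'.blank f))
  rw [fSt_md2, update_fSt_md2] at hc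
  refine (h0.seq (hpre.seq (hloop.seq hc))).cast rfl rfl ?_
  have hlenW : (wYT t).length = ((t.take i).flatMap B).length + (f + 1) + (ys.flatMap wIdx ++ (Γ'.ket :: tail)).length := by
    rw [hwYT, wYBlock_eq]
    simp only [List.length_append, List.length_replicate, List.length_cons, List.length_nil]
    omega
  rw [hlenW]
  simp only [List.length_append, List.length_cons, List.length_nil]
  omega

end FSpec

/-! ### The evaluator of `Θ_i` -/

/-- Raise `g` iff neither comparison flag is up (the two unary counters were equal); empty the
flags. [folklore] -/
def thetaFlag : RProg :=
  pop (kr KR.fl2) fun o => match o with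
    | some _ => clear (kr KR.fl3)
    | none => pop (kr KR.fl3) fun o' => match o' with
        | some _ => skip
        | none => push (tb TB.g) Γ'.blank

/-- **The evaluator of `Θ_i`** (block index `i` as ticks in `iu`, kept): count the forced
variables of block `i` by the block pass (target position `0`), read `f_i` off the `Y`-table,
compare the two unary counts, raise `g` iff they are equal; clean up. [folklore] -/
def thetaEval : RProg :=
  copyToG (kr KR.iu) (kr KR.blk) (kr KR.t1) (kr KR.t2) ;; copyToG (kr KR.iu) (kr KR.iu2) (kr KR.t1) (kr KR.t2) ;;
  copyToG (kr KR.bt) (kr KR.btw) (kr KR.t1) (kr KR.t2) ;; blockPass ;; fPart ;;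
  cmpU (kr KR.cntf) (kr KR.u1) (kr KR.fl2) (kr KR.fl3) Γ'.blank ;; thetaFlag ;;
  clear (kr KR.done) ;; clear (kr KR.gt) ;; clear (kr KR.gf)

/-- **`fPart` on any store** (hypothesis form of `runs_fPart`). [folklore] -/
theorem runs_fPart' (R : RStore) (t : List (ℕ × List ℕ)) (i : ℕ) (hi : i < t.length) (hyt : R (kr KR.yt) = wYT t)
    (ht1 : R (kr KR.t1) = []) (ht2 : R (kr KR.t2) = []) (hytw : R (kr KR.ytw) = []) (hmd2 : R (kr KR.md2) = [])
    (hiu2 : R (kr KR.iu2) = ticks Γ'.blank i) (hu1 : R (kr KR.u1) = []) :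
    Runs fPart R (Function.update (Function.update R (kr KR.iu2) []) (kr KR.u1) (ticks Γ'.blank (t[i]).1))
      (20 * (wYT t).length + 11) := by
  have e := fSt_eta R
  rw [hytw, hmd2, hiu2, hu1] at e
  have h := runs_fPart R t i hi hyt ht1 ht2
  rw [e] at h
  refine h.of_eq ?_ le_rfl
  funext q
  by_cases h1 : q = kr KR.u1; · subst h1; simp
  by_cases h2 : q = kr KR.iu2; · subst h2; simp
  rw [Function.update_of_ne h1, Function.update_of_ne h2]
  by_cases g1 : q = kr KR.ytw; · subst g1; simp [hytw]
  by_cases g2 : q = kr KR.md2; · subst g2; simp [hmd2]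
  rw [fSt_other _ _ _ _ _ g1 g2 h2 h1]

/-- **`thetaFlag`** on any store with comparison flags `fl2 = (f < c)`, `fl3 = (c < f)`. [folklore] -/
theorem runs_thetaFlag (R : RStore) (c f : ℕ) (hfl2 : R (kr KR.fl2) = flagW Γ'.blank (f < c))
    (hfl3 : R (kr KR.fl3) = flagW Γ'.blank (c < f)) (hg : R (tb TB.g) = []) :
    Runs thetaFlag R (Function.update (Function.update (Function.update R (kr KR.fl2) []) (kr KR.fl3) []) (tb TB.g)
      (flagW Γ'.blank (c = f))) 5 := by
  unfold thetaFlag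
  by_cases h1 : f < c
  · rw [flagW_true _ h1] at hfl2
    have h3 : ¬ c < f := by omega
    rw [flagW_false _ h3] at hfl3
    rw [flagW_false _ (by omega : ¬ c = f)]
    have hc := runs_clear (kr KR.fl3) (Function.update R (kr KR.fl2) [])
    have e3 : Function.update R (kr KR.fl2) [] (kr KR.fl3) = [] := by simp [hfl3]
    rw [e3] at hc
    have hc' : Runs (clear (kr KR.fl3)) (Function.update R (kr KR.fl2) [])
        (Function.update (Function.update (Function.update R (kr KR.fl2) []) (kr KR.fl3) []) (tb TB.g) []) 1 := by
      refine hc.of_eq ?_ (by simp)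
      exact (Function.update_eq_self_iff.2 (by simp [hg])).symm
    exact (Runs.pop_cons (k := kr KR.fl2) (a := Γ'.blank) (w := []) hfl2 hc').mono (by norm_num)
  · rw [flagW_false _ h1] at hfl2
    refine Runs.pop_nil hfl2 ?_
    have e2 : Function.update R (kr KR.fl2) [] = R := Function.update_eq_self_iff.2 hfl2.symm
    rw [e2]
    by_cases h2 : c < f
    · rw [flagW_true _ h2] at hfl3
      rw [flagW_false _ (by omega : ¬ c = f)]
      refine (Runs.pop_cons (k := kr KR.fl3) (a := Γ'.blank) (w := []) hfl3 ((Runs.skip _).of_eq ?_ le_rfl)).mono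
        (by norm_num)
      exact (Function.update_eq_self_iff.2 (by simp [hg])).symm
    · rw [flagW_false _ h2] at hfl3
      rw [flagW_true _ (by omega : c = f)]
      have e3 : Function.update R (kr KR.fl3) [] = R := Function.update_eq_self_iff.2 hfl3.symm
      refine (Runs.pop_nil hfl3 (Runs.push' ?_)).mono (by norm_num)
      rw [hg, e3]

/-- **Specification of the `Θ_i`-evaluator** on any store: `g` is raised iff the number of forced
variables of block `i` equals `f_i`. [folklore] -/
theorem runs_thetaEval (R : RStore) (L : List Lit) (hB : BpBase R L) (zsss : List (List (List Entry)))
    (t : List (ℕ × List ℕ)) (i : ℕ) (hi : i < zsss.length) (hne : 0 < (zsss[i]).length) (hit : i < t.length)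
    (hbt : R (kr KR.bt) = wBT zsss) (hyt : R (kr KR.yt) = wYT t) (hiu : R (kr KR.iu) = ticks Γ'.blank i)
    (hblk : R (kr KR.blk) = []) (hiu2 : R (kr KR.iu2) = []) (hbtw : R (kr KR.btw) = []) (hu1 : R (kr KR.u1) = [])
    (hfl2 : R (kr KR.fl2) = []) (hfl3 : R (kr KR.fl3) = []) (hg : R (tb TB.g) = [])
    (hmd2 : R (kr KR.md2) = []) (hpt : R (kr KR.pt) = []) (hpf : R (kr KR.pf) = []) (hlpol : R (kr KR.lpol) = [])
    (hpr : R (kr KR.pr) = []) (hallf : R (kr KR.allf) = []) (hft : R (kr KR.ft) = []) (hff : R (kr KR.ff) = [])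
    (hgt : R (kr KR.gt) = []) (hgf : R (kr KR.gf) = []) (hpos : R (kr KR.pos) = []) (hdone : R (kr KR.done) = [])
    (hru : R (kr KR.ru) = []) (hcntf : R (kr KR.cntf) = []) (hval : R (kr KR.val) = []) (hytw : R (kr KR.ytw) = []) :
    Runs thetaEval R (Function.update R (tb TB.g) (flagW Γ'.blank ((zsss[i]).countP (fr L) = (t[i]).1)))
      ((bpK L + 19) * (wBT zsss).length + 42 * (wYT t).length + 51) := by
  set zs := zsss[i] with hzs
  set c := zs.countP (fr L) with hc
  set f := (t[i]).1 with hf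
  have hcz : c ≤ zs.length := List.countP_le_length
  have hzsW : zs.length + 1 ≤ (wBT zsss).length := by
    have hmem : zs ∈ zsss := by rw [hzs]; exact List.getElem_mem hi
    have h1 : (wBlock zs).length ≤ (wBT zsss).length := by
      unfold wBT
      obtain ⟨s₁, s₂, hs⟩ := List.append_of_mem hmem
      rw [hs]; simp; omega
    have h2 : zs.length + 1 ≤ (wBlock zs).length := by
      unfold wBlock
      simp only [List.length_append, List.length_singleton, Nat.add_le_add_iff_right, List.length_flatMap]
      have : ∀ es ∈ zs, 1 ≤ (wVar es).length := fun es _ => by simp [wVar]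
      calc zs.length = (zs.map fun _ => 1).sum := by simp
        _ ≤ (zs.map fun es => (wVar es).length).sum := List.sum_le_sum (fun es hes => this es hes)
    omega
  have htY : t.length ≤ (wYT t).length := by
    unfold wYT
    rw [List.length_flatMap]
    calc t.length = (t.map fun _ => 1).sum := by simp
      _ ≤ (t.map fun b => (wYBlock b.1 b.2).length).sum :=
          List.sum_le_sum (fun b _ => by simp [wYBlock]; omega)
  have hfY : f ≤ (wYT t).length := by
    have hmem : t[i] ∈ t := List.getElem_mem hit
    obtain ⟨s₁, s₂, hs⟩ := List.append_of_mem hmem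
    unfold wYT
    rw [hs]
    simp only [List.flatMap_append, List.flatMap_cons, List.length_append]
    have : f ≤ (wYBlock (t[i]).1 (t[i]).2).length := by simp [wYBlock, hf]
    omega
  unfold thetaEval
  -- the three copies
  have c1 := runs_copyToG (a := kr KR.iu) (b := kr KR.blk) (t₁ := kr KR.t1) (t₂ := kr KR.t2)
    (by simp) (by simp) (by simp) (by simp) (by simp) (by simp) R hB.t1 hB.t2 hblk
  rw [hiu] at c1
  set R1 := Function.update R (kr KR.blk) (ticks Γ'.blank i) with hR1
  have c2 := runs_copyToG (a := kr KR.iu) (b := kr KR.iu2) (t₁ := kr KR.t1) (t₂ := kr KR.t2)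
    (by simp) (by simp) (by simp) (by simp) (by simp) (by simp) R1 (by simp [hR1, hB.t1]) (by simp [hR1, hB.t2])
    (by simp [hR1, hiu2])
  have e1 : R1 (kr KR.iu) = ticks Γ'.blank i := by simp [hR1, hiu]
  rw [e1] at c2
  set R2 := Function.update R1 (kr KR.iu2) (ticks Γ'.blank i) with hR2
  have c3 := runs_copyToG (a := kr KR.bt) (b := kr KR.btw) (t₁ := kr KR.t1) (t₂ := kr KR.t2)
    (by simp) (by simp) (by simp) (by simp) (by simp) (by simp) R2 (by simp [hR2, hR1, hB.t1]) (by simp [hR2, hR1, hB.t2])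
    (by simp [hR2, hR1, hbtw])
  have e2 : R2 (kr KR.bt) = wBT zsss := by simp [hR2, hR1, hbt]
  rw [e2] at c3
  set R3 := Function.update R2 (kr KR.btw) (wBT zsss) with hR3
  -- the block pass with target position 0
  have hB3 : BpBase R3 L := by
    rw [hR3, hR2, hR1]
    refine BpBase.update_of_ne ?_ _ (by simp) (by simp) (by simp) (by simp) (by simp) (by simp) (by simp) (by simp)
      (by simp) (by simp)
    refine BpBase.update_of_ne ?_ _ (by simp) (by simp) (by simp) (by simp) (by simp) (by simp) (by simp) (by simp)
      (by simp) (by simp)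
    exact hB.update_of_ne _ (by simp) (by simp) (by simp) (by simp) (by simp) (by simp) (by simp) (by simp)
      (by simp) (by simp)
  have hne' : 0 < (zsss[i]).length := hne
  have h4 := runs_blockPass' R3 L hB3 zsss i 0 hi hne' (by simp [hR3]) (by simp [hR3, hR2, hR1])
    (by simp [hR3, hR2, hR1, hpos]) (by simp [hR3, hR2, hR1, hmd2]) (by simp [hR3, hR2, hR1, hpt])
    (by simp [hR3, hR2, hR1, hpf]) (by simp [hR3, hR2, hR1, hlpol]) (by simp [hR3, hR2, hR1, hpr])
    (by simp [hR3, hR2, hR1, hallf]) (by simp [hR3, hR2, hR1, hft]) (by simp [hR3, hR2, hR1, hff])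
    (by simp [hR3, hR2, hR1, hgt]) (by simp [hR3, hR2, hR1, hgf]) (by simp [hR3, hR2, hR1, hdone])
    (by simp [hR3, hR2, hR1, hru]) (by simp [hR3, hR2, hR1, hcntf]) (by simp [hR3, hR2, hR1, hval])
  set R4 := Function.update (Function.update (Function.update (Function.update (Function.update (Function.update
        (Function.update (Function.update R3 (kr KR.btw) []) (kr KR.blk) []) (kr KR.gt) (gtW L zsss[i] 0))
        (kr KR.gf) (gfW L zsss[i] 0)) (kr KR.pos) []) (kr KR.done) [Γ'.blank]) (kr KR.ru) (ruW L zsss[i] 0))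
        (kr KR.cntf) (cntfW L zsss[i]) with hR4
  -- f_i
  have h5 := runs_fPart' R4 t i hit (by simp [hR4, hR3, hR2, hR1, hyt]) (by simp [hR4, hR3, hR2, hR1, hB.t1])
    (by simp [hR4, hR3, hR2, hR1, hB.t2]) (by simp [hR4, hR3, hR2, hR1, hytw]) (by simp [hR4, hR3, hR2, hR1, hmd2])
    (by simp [hR4, hR3, hR2, hR1]) (by simp [hR4, hR3, hR2, hR1, hu1])
  set R5 := Function.update (Function.update R4 (kr KR.iu2) []) (kr KR.u1) (ticks Γ'.blank (t[i]).1) with hR5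
  -- the comparison
  have hcmpSt : cmpSt (kr KR.cntf) (kr KR.u1) (kr KR.fl2) Γ'.blank R5 c f False = R5 := by
    unfold cmpSt
    rw [Function.update_eq_self_iff.2, Function.update_eq_self_iff.2, Function.update_eq_self_iff.2]
    · simp [hR5, hR4, cntfW, ticks, hc, hzs]
    · simp [hR5, ticks, hf]
    · simp [hR5, hR4, hR3, hR2, hR1, hfl2, flagW]
  have h6 := runs_cmpU (a := kr KR.cntf) (b := kr KR.u1) (gt := kr KR.fl2) (lt := kr KR.fl3)
    (by simp) (by simp) (by simp) (by simp) (by simp) (by simp) Γ'.blank R5 c f False False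
    (by simp [hR5, hR4, hR3, hR2, hR1, hfl3, flagW])
  rw [hcmpSt] at h6
  set R6 := Function.update (cmpSt (kr KR.cntf) (kr KR.u1) (kr KR.fl2) Γ'.blank R5 0 0 (False ∨ f < c)) (kr KR.fl3)
    (flagW Γ'.blank (False ∨ c < f)) with hR6
  -- the flag
  have h7 := runs_thetaFlag R6 c f (by simp [hR6, cmpSt]) (by simp [hR6]) (by simp [hR6, cmpSt, hR5, hR4, hR3, hR2, hR1, hg])
  set R7 := Function.update (Function.update (Function.update R6 (kr KR.fl2) []) (kr KR.fl3) []) (tb TB.g)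
    (flagW Γ'.blank (c = f)) with hR7
  -- cleanup
  have h8 := runs_clear (kr KR.done) R7
  have e8 : R7 (kr KR.done) = [Γ'.blank] := by simp [hR7, hR6, cmpSt, hR5, hR4]
  rw [e8] at h8
  set R8 := Function.update R7 (kr KR.done) [] with hR8
  have h9 := runs_clear (kr KR.gt) R8
  have l9 : (R8 (kr KR.gt)).length ≤ 1 := by
    simp only [hR8, hR7, hR6, cmpSt, hR5, hR4]
    simp only [ne_eq, reduceCtorEq, not_false_eq_true, Function.update_of_ne, Sum.inr.injEq, Function.update_self]
    unfold gtW; split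
    · exact length_flagW_le _ _
    · simp
  set R9 := Function.update R8 (kr KR.gt) [] with hR9
  have h10 := runs_clear (kr KR.gf) R9
  have l10 : (R9 (kr KR.gf)).length ≤ 1 := by
    simp only [hR9, hR8, hR7, hR6, cmpSt, hR5, hR4]
    simp only [ne_eq, reduceCtorEq, not_false_eq_true, Function.update_of_ne, Sum.inr.injEq, Function.update_self]
    unfold gfW; split
    · exact length_flagW_le _ _
    · simp
  refine (c1.seq (c2.seq (c3.seq (h4.seq (h5.seq (h6.seq (h7.seq (h8.seq (h9.seq h10))))))))).of_eq ?_ ?_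
  · funext q
    simp only [hR9, hR8, hR7, hR6, cmpSt, hR5, hR4, hR3, hR2, hR1]
    by_cases q1 : q = kr KR.gf; · subst q1; simp [hgf]
    by_cases q2 : q = kr KR.gt; · subst q2; simp [hgt]
    by_cases q3 : q = kr KR.done; · subst q3; simp [hdone]
    by_cases q4 : q = tb TB.g; · subst q4; simp [hc, hf, hzs]
    by_cases q5 : q = kr KR.fl3; · subst q5; simp [hfl3]
    by_cases q6 : q = kr KR.fl2; · subst q6; simp [hfl2]
    by_cases q7 : q = kr KR.u1; · subst q7; simp [hu1]
    by_cases q8 : q = kr KR.cntf; · subst q8; simp [hcntf]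
    by_cases q9 : q = kr KR.iu2; · subst q9; simp [hiu2]
    by_cases q10 : q = kr KR.ru; · subst q10; simp [hru, ruW]
    by_cases q11 : q = kr KR.pos; · subst q11; simp [hpos]
    by_cases q12 : q = kr KR.blk; · subst q12; simp [hblk]
    by_cases q13 : q = kr KR.btw; · subst q13; simp [hbtw]
    simp [Function.update_of_ne, q1, q2, q3, q4, q5, q6, q7, q8, q9, q10, q11, q12, q13]
  · have hK : 60 ≤ bpK L := by simp [bpK]
    simp only [length_ticks, List.length_singleton]
    have hi' : i ≤ (wYT t).length := by omega
    nlinarith [hcz, hzsW, hfY, hi', l9, l10]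

/-! ### The evaluators compute `gClause` and `theta` -/

section Functional

variable (P : Params) (F : List (List (ℕ × Bool)))

/-- The table predicates at the tuple `V.zip bs` are the forcing predicates at `asg V bs`.
[folklore] -/
theorem fT_entries (V : List ℕ) (bs : List Bool) (hbs : bs.length = V.length) (z : ℕ) :
    fT (V.zip bs) (entries P F z) = ftab P F z (asg V bs) ∧ fF (V.zip bs) (entries P F z) = ffab P F z (asg V bs) := by
  have hw : asg V bs = fun ν => lookupB (V.zip bs) ν := funext (asg_eq_lookupB V bs hbs)
  unfold fT fF ftab ffab
  rw [hw]
  constructor <;> exact any_congr_mem _ fun e _ => by rw [allFalse_eq]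

/-- `fr` at the tuple is `forcedT`. [folklore] -/
theorem fr_entries (V : List ℕ) (bs : List Bool) (hbs : bs.length = V.length) (z : ℕ) :
    fr (V.zip bs) (entries P F z) = forcedT P F z (asg V bs) := by
  obtain ⟨h1, h2⟩ := fT_entries P F V bs hbs z
  rw [fr, forcedT, h1, h2]

/-- A `B`-variable lies in a nonempty block, hence before `numNB`. [folklore] -/
theorem blockOf_lt_numNB {x : ℕ} (hx : x ∈ bList P F) : blockOf P F x < numNB P F := by
  by_contra h
  have := block_eq_nil_of_numNB_le P F (not_lt.1 h)
  have hm := mem_block_blockOf P F hx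
  rw [this] at hm; simp at hm

/-- **The value of a `B`-literal computed from the tables is `Ψ_x`.** [folklore] -/
theorem bval_eq_psi (V : List ℕ) (bs : List Bool) (hbs : bs.length = V.length) {x : ℕ} (hx : x ∈ bList P F) :
    bval (V.zip bs) (btab P F) (ytab P F) (blockOf P F x) (posIn P F x) = psi P F x (asg V bs) := by
  set i := blockOf P F x with hi
  set j := posIn P F x with hj
  have hiN : i < numNB P F := blockOf_lt_numNB P F hx
  obtain ⟨hjlt, hxj⟩ := getElem_block_blockOf P F hx
  have hbt : (btab P F)[i]? = some ((block P F i).map (entries P F)) := by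
    unfold btab; rw [List.getElem?_map, List.getElem?_range hiN]; rfl
  have hyt : (ytab P F)[i]? = some (fAt P F i, (List.range (ycount P F i)).map (newIdxY P F i)) := by
    unfold ytab; rw [List.getElem?_map, List.getElem?_range hiN]; rfl
  have hes : ((block P F i).map (entries P F))[j]? = some (entries P F x) := by
    rw [List.getElem?_map, hi, hj, List.getElem?_eq_getElem hjlt]
    simp only [Option.map_some, hxj]
  unfold bval
  simp only [hbt, Option.getD_some, hes, hyt, Option.map_some]
  obtain ⟨h1, h2⟩ := fT_entries P F V bs hbs x
  have h3 : ((((block P F i).map (entries P F)).take j).countP fun e => !fr (V.zip bs) e) =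
      unforcedBefore P F x (aOf P F (asg V bs)) := by
    rw [unforcedBefore_eq, ← List.map_take, List.countP_map]
    exact countP_congr_mem _ fun z _ => by simp [fr_entries P F V bs hbs]
  have h4 : yLook (V.zip bs) ((List.range (ycount P F i)).map (newIdxY P F i))
      (unforcedBefore P F x (aOf P F (asg V bs))) = yval P F x (asg V bs) := by
    rw [yval_eq, yLook]
    set r := unforcedBefore P F x (aOf P F (asg V bs))
    by_cases hr : r < ycount P F (blockOf P F x)
    · rw [if_pos hr, ← hi] at *
      rw [List.getElem?_map, List.getElem?_range hr]
      simp [newIdxY, asg_eq_lookupB V bs hbs]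
    · rw [if_neg hr, ← hi] at *
      rw [List.getElem?_map, List.getElem?_eq_none (by simp; omega)]
      rfl
  rw [h3, h4, h1, h2, psi_eq, forcedT]

/-- **The scan of the annotated clause computes `gClause`.** [folklore] -/
theorem alSat_eq_gClause (V : List ℕ) (bs : List Bool) (hbs : bs.length = V.length) (c : List (ℕ × Bool)) :
    alSat (V.zip bs) (btab P F) (ytab P F) (c.map (annLit P F)) = gClause P F c (asg V bs) := by
  unfold alSat gClause
  rw [List.any_map]
  refine any_congr_mem c fun l _ => ?_
  simp only [Function.comp_apply]
  unfold annLit valVar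
  by_cases hB : inB P F l.1 = true
  · rw [if_pos hB, if_pos hB]
    simp only [alVal, ALit.pol]
    rw [bval_eq_psi P F V bs hbs ((mem_bList P F).2 hB)]
  · rw [if_neg hB, if_neg hB]
    simp only [alVal, ALit.pol]
    rw [asg_eq_lookupB V bs hbs]

/-- The annotations of the literals of `F` refer to existing blocks and positions. [folklore] -/
theorem annLit_wf (l : ℕ × Bool) : (annLit P F l).WF (btab P F) (ytab P F) := by
  unfold annLit
  by_cases hB : inB P F l.1 = true
  · rw [if_pos hB]
    have hx := (mem_bList P F).2 hB
    have hiN := blockOf_lt_numNB P F hx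
    obtain ⟨hjlt, -⟩ := getElem_block_blockOf P F hx
    refine ⟨by simp [ytab, hiN], ⟨by simp [btab, hiN], ?_⟩⟩
    simp [btab, List.getElem_map, hjlt]
  · rw [if_neg hB]; trivial

/-- **The `Θ_i`-evaluator's test is `theta`.** [folklore] -/
theorem countP_fr_eq_iff_theta (V : List ℕ) (bs : List Bool) (hbs : bs.length = V.length) {i : ℕ}
    (hi : i < numNB P F) :
    ((btab P F)[i]'(by simp [btab, hi])).countP (fr (V.zip bs)) = ((ytab P F)[i]'(by simp [ytab, hi])).1 ↔
      theta P F i (asg V bs) = true := by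
  rw [theta_eq]
  simp only [btab, ytab, List.getElem_map, List.getElem_range, beq_iff_eq, List.countP_map]
  rw [countP_congr_mem (block P F i) fun z _ => show ((fr (V.zip bs)) ∘ entries P F) z = forcedT P F z (asg V bs)
    from fr_entries P F V bs hbs z]

end Functional

/-! ### The evaluators inside the emission loop -/

/-- What the evaluators need of the work registers: the lookup's and the passes' scratch
registers empty, the block table and the `Y`-table in place. [folklore] -/
structure KBase (T : AStore Γ' KR) (zsss : List (List (List Entry))) (t : List (ℕ × List ℕ)) : Prop where
  /-- scratch -/
  vw : T KR.vw = []
  /-- scratch -/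
  fnd : T KR.fnd = []
  /-- scratch -/
  ex : T KR.ex = []
  /-- scratch -/
  eb : T KR.eb = []
  /-- scratch -/
  lmd : T KR.lmd = []
  /-- scratch -/
  ne : T KR.ne = []
  /-- scratch -/
  x2 : T KR.x2 = []
  /-- scratch -/
  t1 : T KR.t1 = []
  /-- scratch -/
  t2 : T KR.t2 = []
  /-- scratch -/
  btw : T KR.btw = []
  /-- scratch -/
  md2 : T KR.md2 = []
  /-- scratch -/
  pt : T KR.pt = []
  /-- scratch -/
  pf : T KR.pf = []
  /-- scratch -/
  lpol : T KR.lpol = []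
  /-- scratch -/
  allf : T KR.allf = []
  /-- scratch -/
  ft : T KR.ft = []
  /-- scratch -/
  ff : T KR.ff = []
  /-- scratch -/
  gt : T KR.gt = []
  /-- scratch -/
  gf : T KR.gf = []
  /-- scratch -/
  done : T KR.done = []
  /-- scratch -/
  ru : T KR.ru = []
  /-- scratch -/
  cntf : T KR.cntf = []
  /-- scratch -/
  ytw : T KR.ytw = []
  /-- scratch -/
  yv : T KR.yv = []
  /-- the block table -/
  bt : T KR.bt = wBT zsss
  /-- the `Y`-table -/
  yt : T KR.yt = wYT t

/-- The joint store of the emission bank and the work registers satisfies the evaluator's base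
hypotheses as soon as the work registers do. [folklore] -/
theorem KBase.clBase {T : AStore Γ' KR} {zsss : List (List (List Entry))} {t : List (ℕ × List ℕ)}
    (h : KBase T zsss t) (L : List Lit) (acc g go cy md tmp : List Γ') :
    ClBase (Sum.elim (tbSt (cbody L) acc g go cy md tmp) T) L zsss t :=
  { vt := rfl, vw := h.vw, fnd := h.fnd, ex := h.ex, eb := h.eb, lmd := h.lmd, ne := h.ne, x2 := h.x2, t1 := h.t1,
    t2 := h.t2, btw := h.btw, md2 := h.md2, pt := h.pt, pf := h.pf, lpol := h.lpol, allf := h.allf, ft := h.ft,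
    ff := h.ff, gt := h.gt, gf := h.gf, done := h.done, ru := h.ru, cntf := h.cntf, ytw := h.ytw, yv := h.yv,
    bt := h.bt, yt := h.yt }

/-- The scan's own registers are empty. [folklore] -/
structure ScanClean (T : AStore Γ' KR) : Prop where
  /-- scratch -/
  clw : T KR.clw = []
  /-- scratch -/
  md : T KR.md = []
  /-- scratch -/
  pol : T KR.pol = []
  /-- scratch -/
  tag : T KR.tag = []
  /-- scratch -/
  pr : T KR.pr = []
  /-- scratch -/
  blk : T KR.blk = []
  /-- scratch -/
  iu2 : T KR.iu2 = []
  /-- scratch -/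
  pos : T KR.pos = []
  /-- scratch -/
  res : T KR.res = []
  /-- scratch -/
  val : T KR.val = []

/-- The per-symbol budget of the clause scan in terms of the variable list only. [folklore] -/
def evKV (V : List ℕ) (zsss : List (List (List Entry))) (t : List (ℕ × List ℕ)) : ℕ :=
  (60 * (idxLen V + 1) + 14) * ((wBT zsss).length + (wYT t).length) + 60 * (idxLen V + 1)

/-- `bpK` at a tuple of `V`. [folklore] -/
theorem bpK_zip (V : List ℕ) (bs : List Bool) (hbs : bs.length = V.length) : bpK (V.zip bs) = 60 * (idxLen V + 1) := by
  rw [bpK, length_cbody_zip V bs hbs]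

/-- `evK` at a tuple of `V` is `evKV`. [folklore] -/
theorem evK_zip (V : List ℕ) (bs : List Bool) (hbs : bs.length = V.length) (zsss : List (List (List Entry)))
    (t : List (ℕ × List ℕ)) : evK (V.zip bs) zsss t = evKV V zsss t := by
  rw [evK, bpK_zip V bs hbs, length_cbody_zip V bs hbs, evKV]

/-- **The clause evaluator in the shape required by `runs_cnfLoop`.** [folklore] -/
theorem runs_evalClause_elim (T : AStore Γ' KR) (zsss : List (List (List Entry))) (t : List (ℕ × List ℕ))
    (hK : KBase T zsss t) (hS : ScanClean T) (ls : List ALit) (hwf : ∀ al ∈ ls, al.WF zsss t)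
    (hcl : T KR.cl = ls.flatMap wALit) (L : List Lit) (acc : List Γ') :
    Runs evalClause (Sum.elim (tbSt (cbody L) acc [] [] [] [] []) T)
      (Sum.elim (tbSt (cbody L) acc (flagW Γ'.blank (alSat L zsss t ls = true)) [] [] [] []) T)
      ((evK L zsss t + 10) * (ls.flatMap wALit).length + 7) := by
  have h := runs_evalClause (Sum.elim (tbSt (cbody L) acc [] [] [] [] []) T) L zsss t (hK.clBase L acc [] [] [] [] [])
    ls hwf hcl hS.clw hS.md hS.pol hS.tag hS.pr hS.blk hS.iu2 hS.pos hS.res hS.val rfl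
  refine h.of_eq ?_ le_rfl
  show Function.update (Sum.elim (tbSt (cbody L) acc [] [] [] [] []) T) (Sum.inl TB.g) _ = _
  rw [Sum.update_elim_inl, update_tbSt_g]

/-- **The truth-table CNF of a substituted clause is emitted.** For a clause `c` of `F`, with its
annotation in `cl`, the tables of `P`, `F` in `bt`, `yt`, and `V = depClause P F c` in the tuple
register: the emission loop around the clause evaluator pushes `wFam (cnf (gClause P F c) V)`
reversed onto the accumulator. [folklore] -/
theorem runs_cnfLoop_gClause (P : Params) (F : List (List (ℕ × Bool))) (c : List (ℕ × Bool)) (T : AStore Γ' KR)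
    (hK : KBase T (btab P F) (ytab P F)) (hS : ScanClean T)
    (hcl : T KR.cl = (c.map (annLit P F)).flatMap wALit) (V : List ℕ) (acc₀ : List Γ') :
    Runs (cnfLoop evalClause)
      (Sum.elim (tbSt (cbody (V.zip (List.replicate V.length false))) acc₀ [] [Γ'.blank] [] [] []) T)
      (Sum.elim (tbSt (cbody (V.zip (List.replicate V.length false)))
        ((wFam (cnf (gClause P F c) V)).reverse ++ acc₀) [] [] [] [] []) T)
      ((((evKV V (btab P F) (ytab P F) + 10) * ((c.map (annLit P F)).flatMap wALit).length + 7) +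
        22 * idxLen V + 12 + 2) * 2 ^ V.length + 1) := by
  refine runs_cnfLoop_cnf evalClause T V (gClause P F c) _ (fun bs hbs acc => ?_) acc₀
  have h := runs_evalClause_elim T (btab P F) (ytab P F) hK hS (c.map (annLit P F))
    (fun al hal => by obtain ⟨l, -, rfl⟩ := List.mem_map.1 hal; exact annLit_wf P F l) hcl (V.zip bs) acc
  rw [alSat_eq_gClause P F V bs hbs c, evK_zip V bs hbs] at h
  exact h

/-- The `Θ`-evaluator's own registers: the block index in `iu`, the comparison registers empty.
[folklore] -/
structure ThetaClean (T : AStore Γ' KR) (i : ℕ) : Prop where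
  /-- the block index, in unary -/
  iu : T KR.iu = ticks Γ'.blank i
  /-- scratch -/
  u1 : T KR.u1 = []
  /-- scratch -/
  fl2 : T KR.fl2 = []
  /-- scratch -/
  fl3 : T KR.fl3 = []

/-- **The `Θ_i`-evaluator in the shape required by `runs_cnfLoop`.** [folklore] -/
theorem runs_thetaEval_elim (T : AStore Γ' KR) (zsss : List (List (List Entry))) (t : List (ℕ × List ℕ))
    (hK : KBase T zsss t) (hS : ScanClean T) (i : ℕ) (hT : ThetaClean T i) (hi : i < zsss.length)
    (hne : 0 < (zsss[i]).length) (hit : i < t.length) (L : List Lit) (acc : List Γ') :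
    Runs thetaEval (Sum.elim (tbSt (cbody L) acc [] [] [] [] []) T)
      (Sum.elim (tbSt (cbody L) acc (flagW Γ'.blank ((zsss[i]).countP (fr L) = (t[i]).1)) [] [] [] []) T)
      ((bpK L + 19) * (wBT zsss).length + 42 * (wYT t).length + 51) := by
  have hC := hK.clBase L acc [] [] [] [] []
  have h := runs_thetaEval (Sum.elim (tbSt (cbody L) acc [] [] [] [] []) T) L hC.toBpBase zsss t i hi hne hit
    hK.bt hK.yt hT.iu hS.blk hS.iu2 hK.btw hT.u1 hT.fl2 hT.fl3 rfl hK.md2 hK.pt hK.pf hK.lpol hS.pr hK.allf hK.ft hK.ff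
    hK.gt hK.gf hS.pos hK.done hK.ru hK.cntf hS.val hK.ytw
  refine h.of_eq ?_ le_rfl
  show Function.update (Sum.elim (tbSt (cbody L) acc [] [] [] [] []) T) (Sum.inl TB.g) _ = _
  rw [Sum.update_elim_inl, update_tbSt_g]

/-- **The truth-table CNF of a slice constraint `Θ_i` is emitted.** For a nonempty block `i`, with
`i` ticks in `iu`, the tables of `P`, `F` in `bt`, `yt`, and `V = depTheta P F i` in the tuple
register: the emission loop around the `Θ`-evaluator pushes `wFam (cnf (theta P F i) V)` reversed
onto the accumulator. [folklore] -/
theorem runs_cnfLoop_theta (P : Params) (F : List (List (ℕ × Bool))) (i : ℕ) (hi : i < numNB P F)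
    (T : AStore Γ' KR) (hK : KBase T (btab P F) (ytab P F)) (hS : ScanClean T) (hT : ThetaClean T i)
    (V : List ℕ) (acc₀ : List Γ') :
    Runs (cnfLoop thetaEval)
      (Sum.elim (tbSt (cbody (V.zip (List.replicate V.length false))) acc₀ [] [Γ'.blank] [] [] []) T)
      (Sum.elim (tbSt (cbody (V.zip (List.replicate V.length false)))
        ((wFam (cnf (theta P F i) V)).reverse ++ acc₀) [] [] [] [] []) T)
      ((((60 * (idxLen V + 1) + 19) * (wBT (btab P F)).length + 42 * (wYT (ytab P F)).length + 51) +
        22 * idxLen V + 12 + 2) * 2 ^ V.length + 1) := by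
  have hib : i < (btab P F).length := by simp [btab, hi]
  have hiy : i < (ytab P F).length := by simp [ytab, hi]
  have hne : 0 < ((btab P F)[i]).length := by
    simp only [btab, List.getElem_map, List.getElem_range, List.length_map]
    exact length_block_pos P F hi
  refine runs_cnfLoop_cnf thetaEval T V (theta P F i) _ (fun bs hbs acc => ?_) acc₀
  have h := runs_thetaEval_elim T (btab P F) (ytab P F) hK hS i hT hib hne hiy (V.zip bs) acc
  rw [flagW_congr _ (countP_fr_eq_iff_theta P F V bs hbs hi), bpK_zip V bs hbs] at h
  exact h

end Literature.Computability.FineGrained.IPRenameM
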